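import Summits.QuantumFields.BalabanUV.Beta.RelInvFactorSandwich
import Summits.QuantumFields.BalabanUV.Beta.ValueHessianGauge

/-!
# `BalabanUV.Beta.SymShiftGaugeBlind` — binder row D1, RULING R-D1-g28-2 FILE E1b: THE LETTER (DG) «the shift's border is invisible to the multiplier block
# of every `G_j`» FROM (Dgrad) «`Dsh_mf` is a finitely supported COARSE-GRADIENT readout» + (Dskew) + (Dff), BY THE GAUGE INVARIANCE OF THE TYPED VALUE
# HESSIAN (`ValueHessianGauge.tsum_E2_mul_grad_eq_zero` ∕ `tsum_grad_mul_E2_eq_zero`, `mmRead (Gsym j) = E2 (j+1)`)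

HONEST FRAMING (cell charter, verbatim): «discharging BetaPertH makes Balaban's UV stability UNCONDITIONAL — a real constructive-QFT result; it is
NOT the continuum limit and NOT the Clay problem.»  HONEST DEPENDENCY: continuum YM on T⁴ ⇐ BetaPertH ∧ nine spine estimates (0/9 proved); BetaPertH
⇐ (D1) ∧ (D4) ∧ CAP+tail; G-an2-4 gates asym, D1 and NE2/3/4.  DERIVED cell leaf (β sub-cell, BINDER-OWNERS row D1 OWNER `b2b-balaban-beta-an2`, gen 28).
WHY (R-D1-g28-2 (S)): with the shifted spread `bhKStepSh Dsh j` the (Sr-conj) induction needs `(G_j ∘ Dsh)_mf = 0` and `(Dsh ∘ G_j)_fm = 0` ((DG), a hypothesis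
of `RelInvFactorSandwich.mm_sandwich_Gsym_bhKStepSh`, `E3ContactFactor.e3OfK_Gsym_bref_inl_inl_of_law`, `ReflectionLocusSymShift.hSrC_JsB12Sym0`).  For an1's shift of
record `Dsh = (Lc^{d+1}∕D!) • mfNeg (dz∘SymLamAt ρ_c)` the multiplier–field block is, as a function of the coarse multiplier leg, a GRADIENT of a finitely supported
coarse potential ((Dgrad)), and the field–multiplier block is minus its transpose ((Dskew)); the multiplier block of `G_j` is the value Hessian `E2 (j+1)`
(`SymShiftedSpread.mmRead_Gsym`), which kills pure gauges (`ValueHessianGauge`, W-LH-E2).  HENCE (DG) — this file.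
WHAT ([folklore]): §1 `tsum_eq_tsum_coarse` (a lattice series supported on the coarse lattice re-indexed by `w = Lc • w′`); §2 **`comp_Gsym_Dsh_inr_inl_of_grad`**
(`(G_j ∘ Dsh)_mf = 0` from (Dff)+(Dgrad)), **`comp_Dsh_Gsym_inl_inr_of_grad`** (`(Dsh ∘ G_j)_fm = 0` from (Dff)+(Dskew)+(Dgrad)).
THE LETTERS (hypotheses, about the displayed shift alone): (Dff) `Dsh_ff = 0`; (Dskew) `Dsh x z (inl a) (inr μ) = −Dsh z x (inr μ) (inl a)`; (Dgrad) `∀ z b, ∃ φ finitely supported,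
∀ x μ, proj Lc x = 0 → Dsh x z (inr μ) (inl b) = φ (quo Lc x + e_μ) − φ (quo Lc x)`.  HONEST: discharges NOTHING of the row; root-level classes 0∕5; tables 0∕5; NOT D1,
NOT `BetaPertH`, NOT continuum, NOT Clay.  No statement of Bałaban's papers, no `[cite:]`, no `Prop` fact, no `def`.  Provenance: β sub-cell, unit beta-an2 gen 28,
2026-08-21 (v1); no existing file touched.
-/

noncomputable section

open Finset
open scoped BigOperators
open Literature.Probability.LatticeModels (Torus.proj)
open Literature.MathematicalPhysics.QuantumFieldTheory
open Literature.MathematicalPhysics.QuantumFieldTheory.Balaban1983to89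
open Literature.MathematicalPhysics.QuantumFieldTheory.Balaban1983to89.Beta
open ExpKernelCalculus (MKer comp)
open AffineAveraging (unitVec)
open LatticeForm (quo)
open OneStepResolventKernel (Fib proj_zsmul quo_zsmul eq_zsmul_quo_of_proj)
open BalabanStepJetsSucc (mmRead mmRead_inl_inl E2)
open Summit.QuantumFields.BalabanUV.Beta.TameKernelCalculus
open Summit.QuantumFields.BalabanUV.Beta.SymmetrisedStepJets (Gsym)
open Summit.QuantumFields.BalabanUV.Beta.SymShiftedSpread (mmRead_Gsym)
open Summit.QuantumFields.BalabanUV.Beta.ValueHessianGauge (tsum_E2_mul_grad_eq_zero tsum_grad_mul_E2_eq_zero)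
open Summit.QuantumFields.BalabanUV.Beta.RelInvFactorSandwich (comp_apply' comp_row_eq_zero comp_col_eq_zero Gsym_inr_row_coarse Gsym_inr_col_coarse)

namespace Summit.QuantumFields.BalabanUV.Beta.SymShiftGaugeBlind

variable {d : ℕ} {Lc : ℕ} [NeZero Lc]

/-! ## §1 Series supported on the coarse lattice -/

/-- [folklore] **A LATTICE SERIES SUPPORTED ON THE COARSE SUBLATTICE IS RE-INDEXED BY `w = Lc • w′`.** -/
theorem tsum_eq_tsum_coarse {f : (Fin (d + 1) → ℤ) → ℝ} (hf : ∀ w, Torus.proj Lc w ≠ 0 → f w = 0) :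
    ∑' w, f w = ∑' w', f ((Lc : ℤ) • w') := by
  have hinj : Function.Injective fun w' : Fin (d + 1) → ℤ => (Lc : ℤ) • w' := fun a b h => by
    simpa only [quo_zsmul] using congrArg (quo Lc) h
  refine (hinj.tsum_eq (f := f) fun w hw => ?_).symm
  have hp : Torus.proj Lc w = 0 := by
    by_contra h
    exact hw (hf w h)
  exact ⟨quo Lc w, (eq_zsmul_quo_of_proj hp).symm⟩

/-! ## §2 (DG) from (Dff), (Dskew), (Dgrad) -/

variable {Dsh : MKer (d + 1) (Fib d)}

/-- [folklore] **`(G_j ∘ Dsh)_mf = 0`** from (Dff) and (Dgrad): the multiplier block of `G_j` is `E2 (j+1)` read on the coarse lattice, and `E2` kills the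
coarse gradient of the finitely supported potential behind `Dsh_mf`. -/
theorem comp_Gsym_Dsh_inr_inl_of_grad (hDff : ∀ (x z : Fin (d + 1) → ℤ) (β β' : Fin (d + 1)), Dsh x z (Sum.inl β) (Sum.inl β') = 0)
    (hDgrad : ∀ (z : Fin (d + 1) → ℤ) (b : Fin (d + 1)), ∃ φ : (Fin (d + 1) → ℤ) → ℝ, (Function.support φ).Finite ∧
      ∀ (x : Fin (d + 1) → ℤ) (μ : Fin (d + 1)), Torus.proj Lc x = 0 → Dsh x z (Sum.inr μ) (Sum.inl b) = φ (quo Lc x + unitVec μ) - φ (quo Lc x))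
    (j : ℕ) (x z : Fin (d + 1) → ℤ) (m b : Fin (d + 1)) :
    comp (Gsym (d := d) Lc j) Dsh x z (Sum.inr m) (Sum.inl b) = 0 := by
  by_cases hx : Torus.proj Lc x = 0
  · obtain ⟨φ, hφ, hD⟩ := hDgrad z b
    rw [comp_apply']
    have hs : ∀ w, ∑ f, Gsym (d := d) Lc j x w (Sum.inr m) f * Dsh w z f (Sum.inl b) =
        ∑ μ, Gsym (d := d) Lc j x w (Sum.inr m) (Sum.inr μ) * Dsh w z (Sum.inr μ) (Sum.inl b) := fun w => by
      rw [Fintype.sum_sum_type]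
      simp only [hDff, mul_zero, Finset.sum_const_zero, zero_add]
    simp_rw [hs]
    rw [tsum_eq_tsum_coarse (Lc := Lc) (fun w hw => Finset.sum_eq_zero fun μ _ => by rw [Gsym_inr_col_coarse j x w _ μ hw, zero_mul])]
    have hx' : x = (Lc : ℤ) • quo Lc x := eq_zsmul_quo_of_proj hx
    have h2 : ∀ w' μ, Gsym (d := d) Lc j x ((Lc : ℤ) • w') (Sum.inr m) (Sum.inr μ) * Dsh ((Lc : ℤ) • w') z (Sum.inr μ) (Sum.inl b) =
        E2 d Lc (j + 1) (quo Lc x) w' (Sum.inl m) (Sum.inl μ) * (φ (w' + unitVec μ) - φ w') := fun w' μ => by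
      rw [hD _ μ (proj_zsmul _), quo_zsmul, ← mmRead_Gsym, mmRead_inl_inl, ← hx']
    simp_rw [h2]
    exact tsum_E2_mul_grad_eq_zero (j + 1) m (quo Lc x) hφ
  · exact comp_row_eq_zero (fun y f => Gsym_inr_row_coarse j x y m f hx) z _

/-- [folklore] **`(Dsh ∘ G_j)_fm = 0`** from (Dff), (Dskew) and (Dgrad) (row form of the gauge invariance of `E2 (j+1)`). -/
theorem comp_Dsh_Gsym_inl_inr_of_grad (hDff : ∀ (x z : Fin (d + 1) → ℤ) (β β' : Fin (d + 1)), Dsh x z (Sum.inl β) (Sum.inl β') = 0)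
    (hDskew : ∀ (x z : Fin (d + 1) → ℤ) (a μ : Fin (d + 1)), Dsh x z (Sum.inl a) (Sum.inr μ) = -Dsh z x (Sum.inr μ) (Sum.inl a))
    (hDgrad : ∀ (z : Fin (d + 1) → ℤ) (b : Fin (d + 1)), ∃ φ : (Fin (d + 1) → ℤ) → ℝ, (Function.support φ).Finite ∧
      ∀ (x : Fin (d + 1) → ℤ) (μ : Fin (d + 1)), Torus.proj Lc x = 0 → Dsh x z (Sum.inr μ) (Sum.inl b) = φ (quo Lc x + unitVec μ) - φ (quo Lc x))
    (j : ℕ) (x z : Fin (d + 1) → ℤ) (a m : Fin (d + 1)) :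
    comp Dsh (Gsym (d := d) Lc j) x z (Sum.inl a) (Sum.inr m) = 0 := by
  by_cases hz : Torus.proj Lc z = 0
  · obtain ⟨φ, hφ, hD⟩ := hDgrad x a
    rw [comp_apply']
    have hs : ∀ w, ∑ f, Dsh x w (Sum.inl a) f * Gsym (d := d) Lc j w z f (Sum.inr m) =
        ∑ μ, -(Dsh w x (Sum.inr μ) (Sum.inl a) * Gsym (d := d) Lc j w z (Sum.inr μ) (Sum.inr m)) := fun w => by
      rw [Fintype.sum_sum_type]
      simp only [hDff, zero_mul, Finset.sum_const_zero, zero_add, hDskew, neg_mul]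
    simp_rw [hs]
    rw [tsum_eq_tsum_coarse (Lc := Lc) (fun w hw => Finset.sum_eq_zero fun μ _ => by rw [Gsym_inr_row_coarse j w z μ _ hw, mul_zero, neg_zero])]
    have hz' : z = (Lc : ℤ) • quo Lc z := eq_zsmul_quo_of_proj hz
    have h2 : ∀ w' μ, -(Dsh ((Lc : ℤ) • w') x (Sum.inr μ) (Sum.inl a) * Gsym (d := d) Lc j ((Lc : ℤ) • w') z (Sum.inr μ) (Sum.inr m)) =
        -((φ (w' + unitVec μ) - φ w') * E2 d Lc (j + 1) w' (quo Lc z) (Sum.inl μ) (Sum.inl m)) := fun w' μ => by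
      rw [hD _ μ (proj_zsmul _), quo_zsmul, ← mmRead_Gsym, mmRead_inl_inl, ← hz']
    simp_rw [h2, Finset.sum_neg_distrib, tsum_neg]
    rw [tsum_grad_mul_E2_eq_zero (j + 1) m (quo Lc z) hφ, neg_zero]
  · exact comp_col_eq_zero (fun y f => Gsym_inr_col_coarse j y z f m hz) x _

end Summit.QuantumFields.BalabanUV.Beta.SymShiftGaugeBlind

end
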